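import Mathlib
import Literature.Analysis.Calculus.ScalarImplicitFunction
import HarnessLib
import HarnessLib.Audit

/-!
# SoloInformed — the complex-analytic implicit function of a real polynomial (PRES-RAT(2), Phase III-2)

Solo programme `solo-KontsevichZagierPeriods-informed`, session s110.  The boundary of a
`ℚ`-semialgebraic plane domain is, near a non-special point, the graph `w = a(x)` of a branch of a
polynomial `H(x, w) = 0` with `∂H/∂w ≠ 0`.  To straighten the band `c < w < a(x)` into a cube
germ (complex-analytic near the closed real square) we need the branch as a COMPLEX-analytic
function of `x`.  This file provides it: for `H ∈ K[x, w]` with a coefficient map `f : K → ℂ`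
taking real values, a real zero `(x₀, y₀)` with `∂H/∂w (x₀, y₀) ≠ 0` carries a function `A`,
complex-analytic on a disc `|z − x₀| < ρ`, with `A x₀ = y₀`, `H(z, A z) = 0`, `|A z − y₀| < δ`,
UNIQUENESS of the zeros of `H` in the bidisc `|z − x₀| < ρ, |w − y₀| < δ`, and `A` REAL on real
points (`soloInformed_exists_cxImplicit`).  The implicit function comes from
`Literature.Analysis.Calculus.exists_implicit_of_partial_ne_zero` over `ℂ` with smoothness
`ω` (so the germ is analytic); reality follows from uniqueness applied to `conj (A x)`.
Supporting lemmas: analyticity of polynomial maps in analytic arguments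
(`soloInformed_analyticAt_eval₂_of`) and the partial derivative of the evaluation in the last
variable (`soloInformed_hasDerivAt_evalC_right`, via `MvPolynomial.pderiv`).

References: folklore (holomorphic implicit function theorem in one variable); S. Lang, *Real and
Functional Analysis*, XIV §2; Bochnak–Coste–Roy, *Real Algebraic Geometry*, §2.9 (Nash germs).
-/

noncomputable section

open scoped BigOperators Topology
open Set Filter Metric

namespace Summit.KontsevichZagierPeriods.KontsevichZagierPeriods.Theorems

variable {K : Type*} [CommRing K]

/-! ### Polynomial maps are analytic -/

/-- A polynomial in analytic functions is analytic: if every component `x ↦ v x i` is analytic at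
`x`, so is `x ↦ P^f(v x)`. -/
theorem soloInformed_analyticAt_eval₂_of {E : Type*} [NormedAddCommGroup E] [NormedSpace ℂ E]
    (f : K →+* ℂ) {m : ℕ} (P : MvPolynomial (Fin m) K) {v : E → Fin m → ℂ} {x : E}
    (hv : ∀ i, AnalyticAt ℂ (fun x => v x i) x) :
    AnalyticAt ℂ (fun x => MvPolynomial.eval₂ f (v x) P) x := by
  induction P using MvPolynomial.induction_on with
  | C c => simp only [MvPolynomial.eval₂_C]; exact analyticAt_const
  | add p q hp hq => simp only [MvPolynomial.eval₂_add]; exact hp.add hq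
  | mul_X p i hp => simp only [MvPolynomial.eval₂_mul, MvPolynomial.eval₂_X]; exact hp.mul (hv i)

/-- Complex evaluation of a two-variable polynomial: `H^f(z, w)`. -/
def soloInformedEvalC (f : K →+* ℂ) (H : MvPolynomial (Fin 2) K) (z w : ℂ) : ℂ :=
  MvPolynomial.eval₂ f ![z, w] H

/-- `(z, w) ↦ H^f(z, w)` is analytic in both variables jointly (as a map on `ℂ × ℂ`, in the
order (unknown `w`, parameter `z`) used by the implicit function theorem). -/
theorem soloInformed_analyticAt_evalC_swap (f : K →+* ℂ) (H : MvPolynomial (Fin 2) K)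
    (q : ℂ × ℂ) : AnalyticAt ℂ (fun q : ℂ × ℂ => soloInformedEvalC f H q.2 q.1) q := by
  unfold soloInformedEvalC
  refine soloInformed_analyticAt_eval₂_of f H (v := fun q : ℂ × ℂ => ![q.2, q.1]) fun i => ?_
  fin_cases i
  · simpa using analyticAt_snd
  · simpa using analyticAt_fst

/-- `w ↦ H^f(z, w)` is analytic. -/
theorem soloInformed_analyticAt_evalC_right (f : K →+* ℂ) (H : MvPolynomial (Fin 2) K)
    (z w : ℂ) : AnalyticAt ℂ (fun w => soloInformedEvalC f H z w) w := by
  unfold soloInformedEvalC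
  refine soloInformed_analyticAt_eval₂_of f H (v := fun w : ℂ => ![z, w]) fun i => ?_
  fin_cases i
  · simp only [Fin.zero_eta, Fin.isValue, Matrix.cons_val_zero]; exact analyticAt_const
  · simp only [Fin.mk_one, Fin.isValue, Matrix.cons_val_one, Matrix.cons_val_fin_one]; exact analyticAt_id

/-- `z ↦ H^f(z, w)` is analytic. -/
theorem soloInformed_analyticAt_evalC_left (f : K →+* ℂ) (H : MvPolynomial (Fin 2) K)
    (z w : ℂ) : AnalyticAt ℂ (fun z => soloInformedEvalC f H z w) z := by
  unfold soloInformedEvalC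
  refine soloInformed_analyticAt_eval₂_of f H (v := fun z : ℂ => ![z, w]) fun i => ?_
  fin_cases i
  · simp only [Fin.zero_eta, Fin.isValue, Matrix.cons_val_zero]; exact analyticAt_id
  · simp only [Fin.mk_one, Fin.isValue, Matrix.cons_val_one, Matrix.cons_val_fin_one]; exact analyticAt_const

/-! ### The partial derivative in `w` -/

/-- **`∂/∂w H^f(z, w) = (∂H/∂w)^f(z, w)`** (`MvPolynomial.pderiv 1`). -/
theorem soloInformed_hasDerivAt_evalC_right (f : K →+* ℂ) (H : MvPolynomial (Fin 2) K)
    (z w : ℂ) : HasDerivAt (fun w => soloInformedEvalC f H z w)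
      (soloInformedEvalC f (MvPolynomial.pderiv 1 H) z w) w := by
  unfold soloInformedEvalC
  induction H using MvPolynomial.induction_on with
  | C c =>
    simp only [MvPolynomial.eval₂_C, MvPolynomial.pderiv_C, MvPolynomial.eval₂_zero]
    exact hasDerivAt_const w (f c)
  | add p q hp hq => simp only [MvPolynomial.eval₂_add, map_add]; exact hp.add hq
  | mul_X p i hp =>
    -- the derivative of the variable `![z, w] i` in `w`
    have hvi : HasDerivAt (fun w : ℂ => (![z, w] : Fin 2 → ℂ) i) (if i = 1 then 1 else 0) w := by
      fin_cases i
      · simp only [Fin.zero_eta, Fin.isValue, Matrix.cons_val_zero, zero_ne_one, if_false]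
        exact hasDerivAt_const w z
      · simp only [Fin.mk_one, Fin.isValue, Matrix.cons_val_one, Matrix.cons_val_fin_one, if_true]
        exact hasDerivAt_id w
    have h := hp.mul hvi
    simp only [MvPolynomial.eval₂_mul, MvPolynomial.eval₂_X]
    refine h.congr_deriv ?_
    fin_cases i
    · simp [Derivation.leibniz, MvPolynomial.pderiv_X,
        MvPolynomial.eval₂_mul, MvPolynomial.eval₂_X, smul_eq_mul, mul_comm]
    · simp [Derivation.leibniz, MvPolynomial.pderiv_X, MvPolynomial.eval₂_add,
        MvPolynomial.eval₂_mul, MvPolynomial.eval₂_X, smul_eq_mul, mul_comm, add_comm]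

/-- Conjugation symmetry for real coefficients: `H^f(conj z, conj w) = conj H^f(z, w)`. -/
theorem soloInformed_evalC_conj (f : K →+* ℂ) (hf : ∀ c, (f c).im = 0)
    (H : MvPolynomial (Fin 2) K) (z w : ℂ) :
    soloInformedEvalC f H (starRingEnd ℂ z) (starRingEnd ℂ w) =
      starRingEnd ℂ (soloInformedEvalC f H z w) := by
  unfold soloInformedEvalC
  rw [MvPolynomial.eval₂_comp_left (starRingEnd ℂ) f]
  have hcf : (starRingEnd ℂ).comp f = f := by
    ext c
    exact Complex.conj_eq_iff_im.2 (hf c)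
  rw [hcf]
  congr 1
  funext i
  fin_cases i <;> simp

/-! ### The complex implicit function -/

/-- **Complex-analytic implicit function of a real polynomial at a real point.** Let
`H ∈ K[x, w]` with real coefficient values `f`, `H^f(x₀, y₀) = 0` and `(∂H/∂w)^f(x₀, y₀) ≠ 0` at a
real point. Then there are `ρ, δ > 0` and `A : ℂ → ℂ` analytic on `|z − x₀| < ρ` with
`A x₀ = y₀`, `H^f(z, A z) = 0` and `|A z − y₀| < δ` there, the zeros of `H^f` in the bidisc are
exactly the graph of `A`, and `A` is real on real points. [folklore; this work] -/
theorem soloInformed_exists_cxImplicit (f : K →+* ℂ) (hf : ∀ c, (f c).im = 0)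
    (H : MvPolynomial (Fin 2) K) (x₀ y₀ : ℝ)
    (h0 : soloInformedEvalC f H x₀ y₀ = 0)
    (hd : soloInformedEvalC f (MvPolynomial.pderiv 1 H) x₀ y₀ ≠ 0) :
    ∃ ρ > (0 : ℝ), ∃ δ > (0 : ℝ), ∃ A : ℂ → ℂ,
      AnalyticOnNhd ℂ A (ball (x₀ : ℂ) ρ) ∧ A x₀ = y₀ ∧
      (∀ z ∈ ball (x₀ : ℂ) ρ, soloInformedEvalC f H z (A z) = 0) ∧
      (∀ z ∈ ball (x₀ : ℂ) ρ, A z ∈ ball (y₀ : ℂ) δ) ∧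
      (∀ z ∈ ball (x₀ : ℂ) ρ, ∀ w ∈ ball (y₀ : ℂ) δ,
        soloInformedEvalC f H z w = 0 → w = A z) ∧
      (∀ x : ℝ, (x : ℂ) ∈ ball (x₀ : ℂ) ρ → (A x).im = 0) := by
  -- the equation `F (w, z) = H(z, w)`, unknown first
  set F : ℂ × ℂ → ℂ := fun q => soloInformedEvalC f H q.2 q.1 with hF
  set p : ℂ × ℂ := ((y₀ : ℂ), (x₀ : ℂ)) with hp
  have hFa : AnalyticAt ℂ F p := soloInformed_analyticAt_evalC_swap f H p
  have hFc : ContDiffAt ℂ ⊤ F p := hFa.contDiffAt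
  have hx : HasDerivAt (fun w => F (w, p.2)) (soloInformedEvalC f (MvPolynomial.pderiv 1 H) x₀ y₀) p.1 := by
    simpa [hF, hp] using soloInformed_hasDerivAt_evalC_right f H x₀ y₀
  have hy : HasDerivAt (fun z => F (p.1, z)) (deriv (fun z => F (p.1, z)) p.2) p.2 := by
    have : DifferentiableAt ℂ (fun z => F (p.1, z)) p.2 := by
      simpa [hF, hp] using (soloInformed_analyticAt_evalC_left f H x₀ y₀).differentiableAt
    exact this.hasDerivAt
  have hp0 : F p = 0 := by simpa [hF, hp] using h0
  obtain ⟨g, hg0, hgc, hzero, huniq, -⟩ :=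
    Literature.Analysis.Calculus.exists_implicit_of_partial_ne_zero (𝕜 := ℂ) (n := ⊤) hFc le_top
      hx hy hd hp0
  simp only [hp] at hg0 hgc hzero huniq
  -- analyticity of `g` near `x₀`
  have hga : AnalyticAt ℂ g x₀ := hgc.analyticAt
  -- the uniqueness window
  obtain ⟨ε, hε, hU⟩ := Metric.eventually_nhds_iff.1 huniq
  -- eventualities at `x₀`
  have e1 : ∀ᶠ z in 𝓝 (x₀ : ℂ), AnalyticAt ℂ g z := hga.eventually_analyticAt
  have e3 : ∀ᶠ z in 𝓝 (x₀ : ℂ), g z ∈ ball (y₀ : ℂ) ε := by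
    have := hga.continuousAt
    rw [ContinuousAt, hg0] at this
    exact this (ball_mem_nhds _ hε)
  obtain ⟨ρ₀, hρ₀, hB⟩ := Metric.eventually_nhds_iff.1 (e1.and (hzero.and e3))
  refine ⟨min ρ₀ ε, lt_min hρ₀ hε, ε, hε, g, fun z hz => (hB (lt_of_lt_of_le hz (min_le_left _ _))).1,
    hg0, fun z hz => ?_, fun z hz => (hB (lt_of_lt_of_le hz (min_le_left _ _))).2.2,
    fun z hz w hw hzw => ?_, fun x hx => ?_⟩
  · have := (hB (lt_of_lt_of_le (mem_ball.1 hz) (min_le_left _ _))).2.1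
    simpa [hF] using this
  · have hq : dist (w, z) ((y₀ : ℂ), (x₀ : ℂ)) < ε := by
      rw [Prod.dist_eq]
      exact max_lt (mem_ball.1 hw) (lt_of_lt_of_le (mem_ball.1 hz) (min_le_right _ _))
    have := hU hq (by simpa [hF] using hzw)
    simpa using this
  · -- reality: `conj (g x)` is a zero in the window, hence equals `g x`
    have hzx : (x : ℂ) ∈ ball (x₀ : ℂ) (min ρ₀ ε) := hx
    have hρx : dist (x : ℂ) x₀ < ρ₀ := lt_of_lt_of_le (mem_ball.1 hzx) (min_le_left _ _)
    have hgx0 : soloInformedEvalC f H x (g x) = 0 := by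
      simpa [hF] using (hB hρx).2.1
    have hgxδ : g x ∈ ball (y₀ : ℂ) ε := (hB hρx).2.2
    have hconj0 : soloInformedEvalC f H x (starRingEnd ℂ (g x)) = 0 := by
      have := soloInformed_evalC_conj f hf H x (g x)
      rw [Complex.conj_ofReal] at this
      rw [this, hgx0, map_zero]
    have hconjδ : starRingEnd ℂ (g x) ∈ ball (y₀ : ℂ) ε := by
      rw [mem_ball] at hgxδ ⊢
      rw [Complex.dist_eq] at hgxδ ⊢
      have hsub : starRingEnd ℂ (g x) - (y₀ : ℂ) = starRingEnd ℂ (g x - y₀) := by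
        rw [map_sub, Complex.conj_ofReal]
      rw [hsub, Complex.norm_conj]
      exact hgxδ
    have hq : dist (starRingEnd ℂ (g x), (x : ℂ)) ((y₀ : ℂ), (x₀ : ℂ)) < ε := by
      rw [Prod.dist_eq]
      exact max_lt (mem_ball.1 hconjδ) (lt_of_lt_of_le (mem_ball.1 hzx) (min_le_right _ _))
    have heq : starRingEnd ℂ (g x) = g x := by
      have := hU hq (by simpa [hF] using hconj0)
      simpa using this
    exact Complex.conj_eq_iff_im.1 heq

end Summit.KontsevichZagierPeriods.KontsevichZagierPeriods.Theorems
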